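import Mathlib.GroupTheory.Archimedean
import Mathlib.Data.ZMod.QuotientGroup
import Literature.AnabelianGeometry.AbsoluteAnabelian.FreeProcyclicModel
import Literature.AnabelianGeometry.AbsoluteAnabelian.AbsTopIThm26iiSigmaStar
import Literature.AnabelianGeometry.SemiGraphs.Coverticial
import HarnessLib

/-!
# `Ẑ_Σ^m = ∏_{l ∈ Σ} ℤ_l^m` IS THE PRO-`Σ` COMPLETION OF `ℤ^m` (model theorem for `IsProSigmaCompletion`)

[AbsTopI] (S. Mochizuki, *Topics in Absolute Anabelian Geometry I*, 2012) Thm 2.6 (ii), proof p. 23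
("`Q_l := Q ⊗ ℤ_l` … the `ℤ_l`-ranks … are independent of `l ∈ Σ`"), typed by abc-iut-w6-d074 through
the MODEL `HatZSigmaPow Σ m := Multiplicative (Fin m → ∏_{l prime, l ∈ Σ} ℤ_l)` of the free pro-`Σ`
abelian group `Ẑ_Σ^m` (`AbsTopIThm26iiSigmaStar.lean`); [CombGC] Rmk 1.1.5 p. 8 / [SemiAnbd] Ex. 2.10
p. 31 use "a free `Ẑ^Σ`-module of rank `m`" in the currency `IsProSigmaCompletion Σ (ι : ℤ^m → M)`
(abc-iut-L3-t1's interface `SemiGraphOfAnabelioids.IsProSigmaCompletion`).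

This PROOF-ONLY file (no definition, no instance, no named fact; abc-iut cell, block F seat
abc-iut-f-090 gen 3, brick «HATZSIGMAPOW-COMPLETION» for row «STAR-SPLIT-NONABELIAN»-Σ) proves that the
two currencies agree: the diagonal map `κ : ℤ^m → Ẑ_Σ^m`, `x ↦ ((x_j)_l)` —

* `HatZSigmaPow.denseRange_cast` — has dense range (CRT: abc-iut-w5-d024's `dense_range_natCast_padicPi`,
  coordinatewise);
* `HatZSigmaPow.isSigmaInteger_index_of_isOpen` — every open subgroup of `Ẑ_Σ^m` has `Σ`-integer index
  (a prime `q ∉ Σ` is a unit in every `ℤ_l`, `l ∈ Σ`, so the `q`-th power map of the finite quotient is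
  surjective, hence injective — Cauchy);
* `HatZSigmaPow.exists_isOpen_comap_eq` — every (normal) subgroup `N ≤ ℤ^m` of `Σ`-integer index `n₀` is
  `κ⁻¹(U)` for an open `U ≤ Ẑ_Σ^m` (first for `n₀ℤ^m`, via abc-iut-w5-d024's open subgroup of index
  `n₀` of `∏_{l ∈ Σ} ℤ_l` and the rigidity "a subgroup of `ℤ` of index `n₀` is `n₀ℤ`"; then for `N ⊇ n₀ℤ^m`
  through the finite quotient `ℤ^m/n₀ℤ^m ≅ Ẑ_Σ^m/U₀`, density giving surjectivity);
* **`HatZSigmaPow.isProSigmaCompletion_cast`** — hence `IsProSigmaCompletion Σ κ`: **`Ẑ_Σ^m` is the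
  pro-`Σ` completion of `ℤ^m`**, for EVERY set `Σ` and every `m`; `HatZSigmaPow.eq_one_of_pow_eq_one` —
  `Ẑ_Σ^m` is torsion-free.

Classical profinite group theory [cite: RibesZalesskii2010, Thm 2.7.1]; nothing here bears on [IUTchIII]
Cor. 3.12; typed ≠ proved elsewhere.
-/

noncomputable section

open Topology

namespace Literature.AnabelianGeometry.AbsoluteAnabelian

namespace HatZSigmaPow

open Literature.AnabelianGeometry.Anabelioids (IsSigmaInteger)
open Literature.AnabelianGeometry.SemiGraphs.SemiGraphOfAnabelioids (IsProSigmaCompletion)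

variable (S : Set ℕ) (m : ℕ)

/-- **`Ẑ_Σ^m` is torsion-free**: `z ^ n = 1`, `n ≠ 0` ⇒ `z = 1` (coordinatewise in the domains `ℤ_l`
of characteristic `0`). [cite: RibesZalesskii2010, Thm 2.7.1] -/
theorem eq_one_of_pow_eq_one {z : HatZSigmaPow S m} {n : ℕ} (hn : n ≠ 0) (hz : z ^ n = 1) : z = 1 := by
  have h : Multiplicative.toAdd z = 0 := by
    have h2 : n • Multiplicative.toAdd z = 0 := by rw [← toAdd_pow, hz, toAdd_one]
    funext j l
    have h3 : (n : @PadicInt l.1 ⟨l.2.1⟩) * Multiplicative.toAdd z j l = 0 := by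
      have := congr_fun (congr_fun h2 j) l
      rwa [Pi.smul_apply, Pi.smul_apply, nsmul_eq_mul, Pi.zero_apply, Pi.zero_apply] at this
    rcases mul_eq_zero.mp h3 with h4 | h4
    · exact absurd h4 (by exact_mod_cast hn)
    · exact h4
  rw [← ofAdd_toAdd z, h, ofAdd_zero]

/-- **`ℤ^m` is dense in `Ẑ_Σ^m`** along the diagonal `κ : x ↦ ((x_j)_l)` (CRT per coordinate, then the
product over `Fin m`). [cite: RibesZalesskii2010, Thm 2.7.1] -/
theorem denseRange_cast :
    DenseRange (AddMonoidHom.toMultiplicative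
      ((Int.castAddHom (∀ l : {l : ℕ // l.Prime ∧ l ∈ S}, @PadicInt l.1 ⟨l.2.1⟩)).compLeft (Fin m))) := by
  haveI : ∀ l : {l : ℕ // l.Prime ∧ l ∈ S}, Fact (Nat.Prime l.1) := fun l => ⟨l.2.1⟩
  -- density of `ℕ` (hence `ℤ`) in `∏_{l ∈ Σ} ℤ_l`
  have hP : Function.Injective (fun l : {l : ℕ // l.Prime ∧ l ∈ S} => l.1) :=
    fun a b h => Subtype.ext h
  have hdN := dense_range_natCast_padicPi (fun l : {l : ℕ // l.Prime ∧ l ∈ S} => l.1) hP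
  have hdZ : Dense (Set.range (fun z : ℤ =>
      (fun l : {l : ℕ // l.Prime ∧ l ∈ S} => ((z : ℤ) : @PadicInt l.1 ⟨l.2.1⟩)))) := by
    refine hdN.mono ?_
    rintro _ ⟨n, rfl⟩
    exact ⟨(n : ℤ), funext fun l => by simp⟩
  -- the product over `Fin m`
  have hpi : Dense (Set.pi Set.univ (fun _ : Fin m => Set.range (fun z : ℤ =>
      (fun l : {l : ℕ // l.Prime ∧ l ∈ S} => ((z : ℤ) : @PadicInt l.1 ⟨l.2.1⟩))))) :=
    dense_pi Set.univ fun _ _ => hdZ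
  have hsub : Set.pi Set.univ (fun _ : Fin m => Set.range (fun z : ℤ =>
      (fun l : {l : ℕ // l.Prime ∧ l ∈ S} => ((z : ℤ) : @PadicInt l.1 ⟨l.2.1⟩)))) ⊆
      Set.range (fun x : Fin m → ℤ => fun j (l : {l : ℕ // l.Prime ∧ l ∈ S}) =>
        ((x j : ℤ) : @PadicInt l.1 ⟨l.2.1⟩)) := by
    intro f hf
    choose x hx using fun j => (Set.mem_pi.mp hf j (Set.mem_univ j))
    exact ⟨x, funext fun j => hx j⟩
  have hdA : Dense (Set.range (fun x : Fin m → ℤ => fun j (l : {l : ℕ // l.Prime ∧ l ∈ S}) =>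
      ((x j : ℤ) : @PadicInt l.1 ⟨l.2.1⟩))) := hpi.mono hsub
  -- transfer to the multiplicative copy
  have heq : Set.range (AddMonoidHom.toMultiplicative
      ((Int.castAddHom (∀ l : {l : ℕ // l.Prime ∧ l ∈ S}, @PadicInt l.1 ⟨l.2.1⟩)).compLeft (Fin m))) =
      Multiplicative.ofAdd '' Set.range (fun x : Fin m → ℤ => fun j (l : {l : ℕ // l.Prime ∧ l ∈ S}) =>
        ((x j : ℤ) : @PadicInt l.1 ⟨l.2.1⟩)) := by
    ext y
    constructor
    · rintro ⟨x, rfl⟩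
      exact ⟨_, ⟨Multiplicative.toAdd x, rfl⟩, rfl⟩
    · rintro ⟨_, ⟨x, rfl⟩, rfl⟩
      exact ⟨Multiplicative.ofAdd x, rfl⟩
  change Dense (Set.range _)
  rw [heq]
  exact Multiplicative.ofAdd.surjective.denseRange.dense_image continuous_ofAdd hdA

/-- `ℤ` is dense in `∏_{l ∈ Σ} ℤ_l` along the diagonal (CRT, abc-iut-w5-d024's
`dense_range_natCast_padicPi`). [cite: RibesZalesskii2010, Thm 2.7.1] -/
theorem dense_range_intCast_pi :
    Dense (Set.range (fun z : ℤ =>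
      (fun l : {l : ℕ // l.Prime ∧ l ∈ S} => ((z : ℤ) : @PadicInt l.1 ⟨l.2.1⟩)))) := by
  haveI : ∀ l : {l : ℕ // l.Prime ∧ l ∈ S}, Fact (Nat.Prime l.1) := fun l => ⟨l.2.1⟩
  have hP : Function.Injective (fun l : {l : ℕ // l.Prime ∧ l ∈ S} => l.1) :=
    fun a b h => Subtype.ext h
  refine (dense_range_natCast_padicPi (fun l : {l : ℕ // l.Prime ∧ l ∈ S} => l.1) hP).mono ?_
  rintro _ ⟨n, rfl⟩
  exact ⟨(n : ℤ), funext fun l => by simp⟩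

/-! ### Open subgroups of `Ẑ_Σ^m` have `Σ`-integer index -/

/-- A prime `q ∉ Σ` divides the index of no open subgroup of `Ẑ_Σ^m`: `q` is a unit in every `ℤ_l`,
`l ∈ Σ`, so the `q`-th power map of the finite quotient is surjective, hence injective — against
Cauchy's theorem (the argument of abc-iut-w5-d024's `not_dvd_index_of_isOpen_padicPi`).
[cite: RibesZalesskii2010, Thm 2.7.1] -/
theorem not_dvd_index_of_isOpen {q : ℕ} (hq : q.Prime) (hqS : q ∉ S)
    (K : Subgroup (HatZSigmaPow S m)) (hK : IsOpen (K : Set (HatZSigmaPow S m))) :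
    ¬ q ∣ K.index := by
  classical
  intro hdvd
  haveI : Finite (HatZSigmaPow S m ⧸ K) := Subgroup.quotient_finite_of_isOpen K hK
  haveI : Fact q.Prime := ⟨hq⟩
  have hunit : ∀ l : {l : ℕ // l.Prime ∧ l ∈ S}, IsUnit ((q : ℕ) : @PadicInt l.1 ⟨l.2.1⟩) := by
    intro l
    haveI : Fact (Nat.Prime l.1) := ⟨l.2.1⟩
    rw [PadicInt.isUnit_iff, PadicInt.norm_natCast_eq_one_iff]
    exact (Nat.coprime_primes l.2.1 hq).mpr fun h => hqS (h ▸ l.2.2)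
  let Q := HatZSigmaPow S m ⧸ K
  have hsurjQ : Function.Surjective (fun z : Q => z ^ q) := by
    intro z
    induction z using QuotientGroup.induction_on with
    | H x =>
      obtain ⟨u, hu⟩ : ∃ u : Fin m → ∀ l : {l : ℕ // l.Prime ∧ l ∈ S}, @PadicInt l.1 ⟨l.2.1⟩,
          (q : Fin m → ∀ l : {l : ℕ // l.Prime ∧ l ∈ S}, @PadicInt l.1 ⟨l.2.1⟩) * u = 1 :=
        ⟨fun j l => (((hunit l).unit⁻¹ : (@PadicInt l.1 ⟨l.2.1⟩)ˣ) : @PadicInt l.1 ⟨l.2.1⟩),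
          funext fun j => funext fun l => by
            change ((q : ℕ) : @PadicInt l.1 ⟨l.2.1⟩) * _ = 1
            exact (hunit l).mul_val_inv⟩
      refine ⟨QuotientGroup.mk (Multiplicative.ofAdd (u * Multiplicative.toAdd x)), ?_⟩
      change QuotientGroup.mk ((Multiplicative.ofAdd (u * Multiplicative.toAdd x)) ^ q) =
        QuotientGroup.mk x
      congr 1
      rw [← ofAdd_nsmul, nsmul_eq_mul, ← mul_assoc, hu, one_mul, ofAdd_toAdd]
  have hinjQ : Function.Injective (fun z : Q => z ^ q) :=
    Finite.injective_iff_surjective.mpr hsurjQ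
  have hcard : q ∣ Nat.card Q := by rwa [← Subgroup.index]
  obtain ⟨z, hz⟩ := exists_prime_orderOf_dvd_card' q hcard
  have hz1 : z ^ q = 1 := by rw [← hz]; exact pow_orderOf_eq_one z
  have : z = 1 := hinjQ (by change z ^ q = 1 ^ q; rw [hz1, one_pow])
  rw [this, orderOf_one] at hz
  exact hq.one_lt.ne hz

/-- **Open subgroups of `Ẑ_Σ^m` have `Σ`-integer index.** [cite: RibesZalesskii2010, Thm 2.7.1] -/
theorem isSigmaInteger_index_of_isOpen (K : Subgroup (HatZSigmaPow S m))
    (hK : IsOpen (K : Set (HatZSigmaPow S m))) : IsSigmaInteger S K.index := by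
  haveI : Finite (HatZSigmaPow S m ⧸ K) := Subgroup.quotient_finite_of_isOpen K hK
  haveI : K.FiniteIndex := Subgroup.finiteIndex_of_finite_quotient
  refine ⟨Nat.pos_of_ne_zero Subgroup.FiniteIndex.index_ne_zero, fun q hq hqK => ?_⟩
  by_contra hqS
  exact not_dvd_index_of_isOpen S m hq hqS K hK hqK

/-! ### Universality: `Σ`-index subgroups of `ℤ^m` are pulled back from open subgroups of `Ẑ_Σ^m` -/

/-- For a `Σ`-integer `n₀`, an open subgroup `U₀ ≤ Ẑ_Σ^m` whose pull-back to `ℤ^m` lies in `n₀ℤ^m`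
(indeed equals it): coordinatewise the open subgroup of index `n₀` of `∏_{l ∈ Σ} ℤ_l`
(abc-iut-w5-d024's `exists_isOpen_subgroup_index_padicPi`), whose pull-back to `ℤ` has index `n₀`
(density) and is therefore `n₀ℤ`. [cite: RibesZalesskii2010, Thm 2.7.1] -/
theorem exists_isOpen_comap_le_pow {n₀ : ℕ} (hn₀ : IsSigmaInteger S n₀) :
    ∃ U₀ : Subgroup (HatZSigmaPow S m), IsOpen (U₀ : Set (HatZSigmaPow S m)) ∧
      ∀ x : Multiplicative (Fin m → ℤ),
        AddMonoidHom.toMultiplicative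
          ((Int.castAddHom (∀ l : {l : ℕ // l.Prime ∧ l ∈ S}, @PadicInt l.1 ⟨l.2.1⟩)).compLeft
            (Fin m)) x ∈ U₀ →
        ∀ j : Fin m, (n₀ : ℤ) ∣ Multiplicative.toAdd x j := by
  classical
  haveI : ∀ l : {l : ℕ // l.Prime ∧ l ∈ S}, Fact (Nat.Prime l.1) := fun l => ⟨l.2.1⟩
  -- the rank-one open subgroup of index `n₀`
  have hfac : ∀ q ∈ n₀.primeFactors, ∃ l : {l : ℕ // l.Prime ∧ l ∈ S},
      (fun l : {l : ℕ // l.Prime ∧ l ∈ S} => l.1) l = q := fun q hq =>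
    ⟨⟨q, Nat.prime_of_mem_primeFactors hq,
      hn₀.2 q (Nat.prime_of_mem_primeFactors hq) (Nat.dvd_of_mem_primeFactors hq)⟩, rfl⟩
  obtain ⟨K₁, hK₁o, hK₁i⟩ :=
    exists_isOpen_subgroup_index_padicPi (fun l : {l : ℕ // l.Prime ∧ l ∈ S} => l.1) hn₀.1.ne' hfac
  -- additive copies
  let A := ∀ l : {l : ℕ // l.Prime ∧ l ∈ S}, @PadicInt l.1 ⟨l.2.1⟩
  let K₁a : AddSubgroup A := AddSubgroup.toSubgroup.symm K₁
  have hmemK₁a : ∀ a : A, a ∈ K₁a ↔ Multiplicative.ofAdd a ∈ K₁ := fun _ => Iff.rfl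
  have hK₁ao : IsOpen (K₁a : Set A) := hK₁o.preimage continuous_ofAdd
  have hK₁ai : K₁a.index = n₀ := by
    rw [← hK₁i, ← AddSubgroup.index_toSubgroup]
    exact congrArg Subgroup.index (AddSubgroup.toSubgroup.apply_symm_apply K₁)
  -- the pull-back to `ℤ` has index `n₀`: `ℤ → A/K₁a` is onto by density
  let δ : ℤ →+ A := Int.castAddHom A
  let f : ℤ →+ A ⧸ K₁a := (QuotientAddGroup.mk' K₁a).comp δ
  have hf : Function.Surjective f := by
    intro y
    induction y using QuotientAddGroup.induction_on with
    | H a =>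
      have hopen : IsOpen ((fun x : A => x - a) ⁻¹' (K₁a : Set A)) :=
        hK₁ao.preimage (continuous_id.sub continuous_const)
      obtain ⟨_, ⟨z, rfl⟩, hmem⟩ :=
        (dense_range_intCast_pi S).exists_mem_open hopen ⟨a, by simp [K₁a.zero_mem]⟩
      refine ⟨z, ?_⟩
      have hδ : δ z = (fun l : {l : ℕ // l.Prime ∧ l ∈ S} => ((z : ℤ) : @PadicInt l.1 ⟨l.2.1⟩)) :=
        funext fun l => rfl
      change QuotientAddGroup.mk (δ z) = QuotientAddGroup.mk a
      rw [QuotientAddGroup.eq, hδ, neg_add_eq_sub, ← neg_sub]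
      exact K₁a.neg_mem hmem
  have hCi : (K₁a.comap δ).index = n₀ := by
    have hker : f.ker = K₁a.comap δ := by
      change ((QuotientAddGroup.mk' K₁a).comp δ).ker = _
      rw [← AddMonoidHom.comap_ker, QuotientAddGroup.ker_mk']
    rw [← hker, AddSubgroup.index_ker, AddMonoidHom.range_eq_top.mpr hf, AddSubgroup.card_top,
      ← AddSubgroup.index_eq_card, hK₁ai]
  -- a subgroup of `ℤ` of index `n₀` is `n₀ℤ`
  have hCle : ∀ z : ℤ, z ∈ K₁a.comap δ → (n₀ : ℤ) ∣ z := by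
    obtain ⟨a, ha⟩ := Int.subgroup_cyclic (K₁a.comap δ)
    rw [← AddSubgroup.zmultiples_eq_closure] at ha
    have hidx : a.natAbs = n₀ := by rw [← Int.index_zmultiples a, ← ha, hCi]
    intro z hz
    rw [ha, Int.mem_zmultiples_iff] at hz
    rw [← hidx]
    exact Int.natAbs_dvd.mpr hz
  -- the open subgroup `U₀ := ⋂_j eval_j⁻¹ K₁`
  let ev : Fin m → (HatZSigmaPow S m →* Multiplicative A) := fun j =>
    AddMonoidHom.toMultiplicative (Pi.evalAddMonoidHom (fun _ : Fin m => A) j)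
  have hev : ∀ j, Continuous (ev j) := fun j =>
    continuous_ofAdd.comp ((continuous_apply j).comp continuous_toAdd)
  refine ⟨⨅ j, K₁.comap (ev j), ?_, fun x hx j => ?_⟩
  · rw [Subgroup.coe_iInf]
    exact isOpen_iInter_of_finite fun j => hK₁o.preimage (hev j)
  · have hxj : ev j (AddMonoidHom.toMultiplicative ((Int.castAddHom A).compLeft (Fin m)) x) ∈ K₁ :=
      Subgroup.mem_iInf.mp hx j
    refine hCle _ ?_
    rw [AddSubgroup.mem_comap, hmemK₁a]
    exact hxj

/-- **Universality.**  Every subgroup `N ≤ ℤ^m` of `Σ`-integer index is the pull-back `κ⁻¹(U)` of an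
open subgroup `U ≤ Ẑ_Σ^m`: with `n₀ := [ℤ^m : N]`, `N ⊇ n₀ℤ^m ⊇ κ⁻¹(U₀)` for the open `U₀` of
`exists_isOpen_comap_le_pow`, and `U` is the pull-back along `Ẑ_Σ^m ↠ Ẑ_Σ^m/U₀` of the image of `N`
under the injection `ℤ^m/κ⁻¹(U₀) ↪ Ẑ_Σ^m/U₀`. [cite: RibesZalesskii2010, Thm 2.7.1] -/
theorem exists_isOpen_comap_eq (N : Subgroup (Multiplicative (Fin m → ℤ)))
    (hN : IsSigmaInteger S N.index) :
    ∃ U : Subgroup (HatZSigmaPow S m), IsOpen (U : Set (HatZSigmaPow S m)) ∧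
      U.comap (AddMonoidHom.toMultiplicative
        ((Int.castAddHom (∀ l : {l : ℕ // l.Prime ∧ l ∈ S}, @PadicInt l.1 ⟨l.2.1⟩)).compLeft
          (Fin m))) = N := by
  classical
  set κ : Multiplicative (Fin m → ℤ) →* HatZSigmaPow S m := AddMonoidHom.toMultiplicative
    ((Int.castAddHom (∀ l : {l : ℕ // l.Prime ∧ l ∈ S}, @PadicInt l.1 ⟨l.2.1⟩)).compLeft (Fin m))
    with hκ
  obtain ⟨U₀, hU₀o, hU₀⟩ := exists_isOpen_comap_le_pow S m hN
  -- `κ⁻¹(U₀) ≤ n₀ℤ^m ≤ N`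
  have hL₀N : U₀.comap κ ≤ N := by
    intro x hx
    choose y hy using hU₀ x hx
    have hxeq : x = (Multiplicative.ofAdd y) ^ N.index := by
      rw [← ofAdd_nsmul, ← ofAdd_toAdd x]
      congr 1
      funext j
      rw [Pi.smul_apply, nsmul_eq_mul]
      exact hy j
    rw [hxeq]
    exact Subgroup.pow_index_mem N _
  -- the induced injection `ℤ^m/κ⁻¹(U₀) ↪ Ẑ_Σ^m/U₀`
  let φ : Multiplicative (Fin m → ℤ) ⧸ U₀.comap κ →* HatZSigmaPow S m ⧸ U₀ :=
    QuotientGroup.map (U₀.comap κ) U₀ κ le_rfl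
  have hφmk : ∀ x, φ (QuotientGroup.mk x) = QuotientGroup.mk (κ x) := fun x => by
    rw [QuotientGroup.map_mk]
  have hφinj : Function.Injective φ := by
    rw [← MonoidHom.ker_eq_bot_iff, eq_bot_iff]
    intro y hy
    induction y using QuotientGroup.induction_on with
    | H x =>
      rw [MonoidHom.mem_ker, hφmk, QuotientGroup.eq_one_iff] at hy
      rw [Subgroup.mem_bot, QuotientGroup.eq_one_iff]
      exact hy
  refine ⟨((N.map (QuotientGroup.mk' (U₀.comap κ))).map φ).comap (QuotientGroup.mk' U₀), ?_, ?_⟩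
  · refine Subgroup.isOpen_mono (fun u hu => ?_) hU₀o
    rw [Subgroup.mem_comap, QuotientGroup.mk'_apply, (QuotientGroup.eq_one_iff u).mpr hu]
    exact Subgroup.one_mem _
  · ext x
    rw [Subgroup.mem_comap, Subgroup.mem_comap, QuotientGroup.mk'_apply, ← hφmk]
    constructor
    · rintro ⟨y, hy, hyx⟩
      have hyx' : y = QuotientGroup.mk x := hφinj hyx
      obtain ⟨n, hn, rfl⟩ := Subgroup.mem_map.mp hy
      rw [QuotientGroup.mk'_apply, QuotientGroup.eq] at hyx'
      have hx : x = n * (n⁻¹ * x) := by rw [mul_inv_cancel_left]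
      rw [hx]
      exact N.mul_mem hn (hL₀N hyx')
    · intro hx
      exact ⟨QuotientGroup.mk' _ x, Subgroup.mem_map_of_mem _ hx, rfl⟩

/-- **`Ẑ_Σ^m = ∏_{l ∈ Σ} ℤ_l^m` is the pro-`Σ` completion of `ℤ^m`**: the diagonal
`κ : ℤ^m → Ẑ_Σ^m`, `x ↦ ((x_j)_l)`, satisfies abc-iut-L3-t1's `IsProSigmaCompletion Σ` — dense range,
open subgroups of `Σ`-integer index, and every `Σ`-index subgroup of `ℤ^m` pulled back from an open
subgroup.  (For `Σ ⊇ 𝔓𝔯𝔦𝔪𝔢𝔰`, `Ẑ_Σ^m ≃ₜ* Ẑ^m`, the profinite completion — abc-iut's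
`nonempty_hatZPow_continuousMulEquiv_hatZSigmaPow`.) [cite: RibesZalesskii2010, Thm 2.7.1] -/
theorem isProSigmaCompletion_cast :
    IsProSigmaCompletion S (AddMonoidHom.toMultiplicative
      ((Int.castAddHom (∀ l : {l : ℕ // l.Prime ∧ l ∈ S}, @PadicInt l.1 ⟨l.2.1⟩)).compLeft (Fin m)) :
        Multiplicative (Fin m → ℤ) →* HatZSigmaPow S m) where
  dense := denseRange_cast S m
  index_open N _ hN := isSigmaInteger_index_of_isOpen S m N hN
  comap_surj N _ hN := exists_isOpen_comap_eq S m N hN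

/-- **`Ẑ_Σ^m` is a pro-`Σ` completion of `ℤ^m`** (packaged: a homomorphism `κ : ℤ^m → Ẑ_Σ^m` with
`κ(x)_{j,l} = x_j ∈ ℤ_l` which is a pro-`Σ` completion). [cite: RibesZalesskii2010, Thm 2.7.1] -/
theorem exists_isProSigmaCompletion :
    ∃ κ : Multiplicative (Fin m → ℤ) →* HatZSigmaPow S m,
      (∀ (x : Multiplicative (Fin m → ℤ)) (j : Fin m) (l : {l : ℕ // l.Prime ∧ l ∈ S}),
          Multiplicative.toAdd (κ x) j l = ((Multiplicative.toAdd x j : ℤ) : @PadicInt l.1 ⟨l.2.1⟩)) ∧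
        IsProSigmaCompletion S κ :=
  ⟨_, fun _ _ _ => rfl, isProSigmaCompletion_cast S m⟩

end HatZSigmaPow

end Literature.AnabelianGeometry.AbsoluteAnabelian

end
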